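import Literature.Topology.FourManifolds.LickorishWallaceTwistSurgery
import Literature.Topology.FourManifolds.GluingSmoothing
import HarnessLib

/-!
# Lickorish–Wallace: the uniqueness-of-gluings leaf (UG) discharged

Topic `Literature/Topology/FourManifolds`; fact seat
`provefact-Literature.Topology.FourManifolds.exists_isIntegralSurgeryLink` (the Lickorish–Wallace
theorem, `SurgeryGluck.lean`; DAG in `LickorishWallace.lean`, `LickorishWallaceTwistSurgery.lean`).

The assembly `Literature.Topology.FourManifolds.exists_isIntegralSurgeryLink_of_leaves`
(`LickorishWallaceTwistSurgery.lean`) reduces the theorem to five named facts, the last of which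
is the uniqueness of gluings in dimension three,
`Literature.Topology.FourManifolds.nonempty_diffeomorph_of_isBoundaryGluing_dimThree` (Hirsch,
*Differential Topology* (1976), Ch. 8, Thm. 2.1; Bröcker–Jänich (1982), (13.9)).  That fact is now
a theorem of the tree in every dimension: `BoundaryGluingData.nonempty_diffeomorph`
(`GluingSmoothing.lean`, the comparison map corrected near the seam by the uniqueness of collars).
This file records the discharge and the shortened assembly:

* `nonempty_diffeomorph_of_isBoundaryGluing_dimThree_holds` — **proved** (UG);
* `exists_isIntegralSurgeryLink_of_isBoundaryGluing_of_isIsotopic_listProd_holds` — leaf **F4**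
  of the DAG (Lickorish's surgery realisation of a product of Dehn twists, Ann. of Math. 76
  (1962), pp. 538–540) is thereby **proved outright**;
* `exists_isIntegralSurgeryLink_of_leaves'` — the Lickorish–Wallace theorem from the four
  remaining named facts: the self-indexing Morse function on closed `3`-manifolds
  (`exists_isMorse_isSelfIndexing 3`, Smale 1961 / Milnor 1965), the genus of a handlebody
  boundary (`IsHandlebody.genus_eq_of_diffeomorph_boundary`), the classification of handlebodies
  (`IsHandlebody.nonempty_diffeomorph`) and the Dehn–Lickorish twist theorem
  (`exists_isDehnTwist_isIsotopic_listProd`).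

## References

* W. B. R. Lickorish, *A representation of orientable combinatorial 3-manifolds*, Ann. of Math.
  (2) 76 (1962), 531–540: Thm. 2 and its proof, pp. 538–540. [LickorishAnnals1962]
* M. W. Hirsch, *Differential Topology*, GTM 33 (1976), Ch. 8 §2, Thm. 2.1. [HirschDT1976]
* Th. Bröcker, K. Jänich, *Introduction to Differential Topology* (1982), (13.9). [BrockerJanich1982]
-/

open scoped Manifold ContDiff Topology
open Set Function

noncomputable section

namespace Literature.Topology.FourManifolds

universe u

/-- **Uniqueness of gluings in dimension three (UG) holds**: the named fact
`Literature.Topology.FourManifolds.nonempty_diffeomorph_of_isBoundaryGluing_dimThree` is a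
theorem, by `BoundaryGluingData.nonempty_diffeomorph` (`GluingSmoothing.lean`; Hirsch (1976),
Ch. 8, Thm. 2.1 with Thm. 1.9) applied to witnesses of the two gluings.
[cite: HirschDT1976, Ch. 8 §2, Thm. 2.1] -/
theorem nonempty_diffeomorph_of_isBoundaryGluing_dimThree_holds :
    nonempty_diffeomorph_of_isBoundaryGluing_dimThree.{u} := by
  intro M N _ _ _ _ _ _ _ _ _ _ _ _ bM bN P P' _ _ _ _ _ _ _ _ _ _ φ hP hP'
  obtain ⟨G⟩ := IsBoundaryGluing.nonempty_boundaryGluingData (φ := φ.toEquiv) hP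
  obtain ⟨G'⟩ := IsBoundaryGluing.nonempty_boundaryGluingData (φ := φ.toEquiv) hP'
  exact G.nonempty_diffeomorph G'

/-- **F4 of the Lickorish–Wallace DAG holds**: a `3`-manifold glued from the two handlebodies of
the standard splitting of `S³` by a map isotopic to (the `S³` gluing map composed with) a product
of Dehn twists is integral surgery on a link in `S³` (Lickorish (1962), proof of Thm. 2,
pp. 538–540, Fig. 11; Schultens (2014), Lemma 7.3.4) — the named fact
`Literature.Topology.FourManifolds.exists_isIntegralSurgeryLink_of_isBoundaryGluing_of_isIsotopic_listProd`
of `LickorishWallace.lean`, from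
`exists_isIntegralSurgeryLink_of_isBoundaryGluing_of_isIsotopic_listProd_of_UG` and UG.
[cite: LickorishAnnals1962, proof of Thm. 2 (pp. 538–540, Fig. 11)] -/
theorem exists_isIntegralSurgeryLink_of_isBoundaryGluing_of_isIsotopic_listProd_holds :
    exists_isIntegralSurgeryLink_of_isBoundaryGluing_of_isIsotopic_listProd.{u} :=
  exists_isIntegralSurgeryLink_of_isBoundaryGluing_of_isIsotopic_listProd_of_UG
    nonempty_diffeomorph_of_isBoundaryGluing_dimThree_holds

/-- **The Lickorish–Wallace theorem (`Literature.Topology.FourManifolds.exists_isIntegralSurgeryLink`,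
Lickorish (1962), Thm. 2: every closed connected orientable `3`-manifold is integral surgery on a
link in `S³`) from the four remaining named facts of its DAG**: the self-indexing Morse function
(`exists_isMorse_isSelfIndexing 3`), the genus of a handlebody boundary
(`IsHandlebody.genus_eq_of_diffeomorph_boundary`), the classification of handlebodies (UNIQ,
`IsHandlebody.nonempty_diffeomorph`) and the Dehn–Lickorish theorem (F3,
`exists_isDehnTwist_isIsotopic_listProd`); F2a, SPLIT, SYMM, F4 and UG being theorems of the tree.
[cite: LickorishAnnals1962, Thm. 2 and its proof (pp. 538–540)] -/
theorem exists_isIntegralSurgeryLink_of_leaves'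
    (hSI : FourManifolds.exists_isMorse_isSelfIndexing.{u} 3)
    (hG : IsHandlebody.genus_eq_of_diffeomorph_boundary.{u})
    (hU : IsHandlebody.nonempty_diffeomorph.{u})
    (h₃ : exists_isDehnTwist_isIsotopic_listProd.{u}) :
    FourManifolds.exists_isIntegralSurgeryLink.{u} :=
  exists_isIntegralSurgeryLink_of_leaves hSI hG hU h₃
    nonempty_diffeomorph_of_isBoundaryGluing_dimThree_holds

end Literature.Topology.FourManifolds
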